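import Summits.ResolutionOfSingularities.ResolutionOfSingularities.Theorems.FrobeniusLadderFInjectiveMacaulayficationOmegaOneS2KNewtonKFan
import Summits.ResolutionOfSingularities.ResolutionOfSingularities.Theorems.FrobeniusLadderFInjectiveMacaulayficationB9PointFloorRowClass
import HarnessLib

/-!
# BED Ω₁ GLOBAL PATCH, F6 (principal branch): THE REFINED CLASS MODEL X̃₂ = Bl_{K″} X_{B9} IS `FullCl p` AT EVERY POINT (class route on the 1223 charts of the global cure fan Σ₂)
# (crux `FInjectiveMacaulayfication` stmt-ResolutionOfSingularities-15315, chain w45a; `g14/F6-ARCHITECTURE.md` (2)•principal; seat res-L1-w45a-stub-3 g14 DRAFT — to be checked once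
# `OmegaOneS2KNewtonK{FanChecks,CoverChecks,Fan}` are in the tree)

[OURS · L1 W4.5a] Support file (`--supports stmt-ResolutionOfSingularities-15315 --as helper`); theorems only; NOT a statement of any manuscript; nothing of the crux is proved (it is the FULL input
of the principal-orbit branch of F6 via ✓ `PrincipalStalkPackage.fullCl_stalk_of_pair_unit` / ✓ `PencilBlowupLocalChartsFull.fullCl_stalk_over_principalChart`). AI-written (verbatim adaptation
of ✓ `B9PointFloorRowClass.affineBlowup_mK_fullCl_b9`, `t = 1223`, centre `K″`). [cite: IshiiSingularities2018, Thm. 4.4.23, Lemma 4.4.24, Cor. 4.4.25; CoxLittleSchenck2011, §11.1]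
-/

set_option linter.dupNamespace false

noncomputable section

open AlgebraicGeometry MvPolynomial Literature.AlgebraicGeometry.Resolution

namespace Summit.ResolutionOfSingularities.ResolutionOfSingularities.Theorems.FInjectiveMacaulayfication.OmegaOneS2ClassRow

open Summit.ResolutionOfSingularities.ResolutionOfSingularities.Theorems.FInjectiveMacaulayfication
open SliceableCentre FanCheckKit OmegaOneS2KNewtonKFan

/-- On every chart of Σ₂, `θ_{V c} f_B9 = Y^{V c · u₀ c} · g_c` with `g_c(0) ≠ 0` — the Newton chart lemma on the tabulated common minimiser (any field). [cite: IshiiSingularities2018, proof of Lemma 4.4.24] -/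
theorem exists_refining_strictTransform (k : Type) [Field k] (f : MvPolynomial (Fin 5) k) (hf : f = X 4 ^ 2 + X 0 ^ 9 + X 1 ^ 9 + X 2 ^ 9 + X 3 ^ 9) (c : Fin 1223) :
    ∃ g : MvPolynomial (Fin 5) k, aeval (fun j : Fin 5 => ∏ i : Fin 5, (X i : MvPolynomial (Fin 5) k) ^ Vq c i j) f =
      monomial (Finsupp.equivFunOnFinite.symm ((Vq c).mulVec ⇑(Finsupp.equivFunOnFinite.symm (U0 c) : Fin 5 →₀ ℕ))) 1 * g ∧ constantCoeff g ≠ 0 :=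
  NewtonChartLemma.exists_theta_eq_monomial_mul_of_commonMinimiser (Vq c) (hV c) f _ (hu₀ k f hf c) (hmin k f hf c)

/-- ★★ **`X̃₂ = Bl_{K″} X_{B9}` IS `FullCl p` AT EVERY POINT** (k = k̄, `2·3 ≠ 0`): the class route on the K″-centre tables of the global cure fan Σ₂ (with the specimen-distinct conjunct
`CL.length = 1223`, which keeps the statement distinct from ✓ `B9PointFloorRowClass.affineBlowup_mK_fullCl_b9` — here `AL2` is the 6032-generator table of `K″`). [OURS · certificate instance] -/
theorem affineBlowup_K2_fullCl_b9 (p : ℕ) [Fact p.Prime] (k : Type) [Field k] [IsAlgClosed k] [CharP k p] (h2 : (2 : k) ≠ 0) (h3 : (3 : k) ≠ 0)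
    (f : MvPolynomial (Fin 5) k) (hf : f = X 4 ^ 2 + X 0 ^ 9 + X 1 ^ 9 + X 2 ^ 9 + X 3 ^ 9) :
    (∀ y : ↥(affineBlowup (Ideal.span ((fun e : Fin 5 →₀ ℕ => Ideal.Quotient.mk (Ideal.span {f}) (monomial e (1 : k))) '' (genSet 5 AL2 : Set (Fin 5 →₀ ℕ))))),
      FullCl p ((affineBlowup (Ideal.span ((fun e : Fin 5 →₀ ℕ => Ideal.Quotient.mk (Ideal.span {f}) (monomial e (1 : k))) '' (genSet 5 AL2 : Set (Fin 5 →₀ ℕ))))).presheaf.stalk y)) ∧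
      CL.length = 1223 := by
  classical
  refine ⟨?_, tlen⟩
  choose g hθ hg0 using exists_refining_strictTransform k f hf
  exact FHalfRowOfNewtonNondegenerate.affineBlowup_fullCl_of_weaklyNondegenerate p k f (B9Specimen.prime_f k h3 f hf)
    (B9PointFloorRowClass.weaklyNondegenerate_b9 k h3 f hf) (B9Specimen.mk_X_ne_zero k h3 f hf)
    (fun x hx => B9Specimen.regular_off_vertex k h2 h3 f hf x.asIdeal hx)
    (genSet 5 AL2) hprimAJ.2.1 hprimAJ.1 1223 (chartM 5 AL2 CL 1223) (hcov k) Vq hV (chartA 5 AL2 CL 1223) haA hgen hge g _ hθ hg0 (OmegaOneS2KNewtonKFan.hv k _)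

end Summit.ResolutionOfSingularities.ResolutionOfSingularities.Theorems.FInjectiveMacaulayfication.OmegaOneS2ClassRow

end
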